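import Mathlib
import Summits.Ventures.PercRepro2.TwoHullMasterPathCoverKey
import Summits.Ventures.PercRepro2.TwoHullMasterBlocksGlue2

/-!
# Cube covers of theta graphs (blind cell PercRepro2, night-4 g40, 2026-08-29;
proofs/NIGHT4-G40.md §12)

The blocks of the canonical path cover are mirrored by the colour swap, so they mirror the hull
pair of `l` (`lMirror_path`); with the parallel composition of covers (`cubeCover_glue2`) every
theta graph whose paths have at least two edges carries a cube cover: **`cubeCover_twoPaths`**
(every cycle through the two marks) and **`cubeCover_theta3`** (three paths; more by iteration) —
the cube-cover conjecture (TwoHullMasterCubeConjecture.lean) on the theta graphs, and (MM) there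
once more (`twoHullMaster_twoPaths_of_cover`).
-/

namespace Summit.Ventures.PercRepro2

namespace Blocks

open Hull LocRows Path2 Glue2

open scoped Classical

variable {V : Type*}

/-- The blocks of the path cover mirror the hull pair of `l`. -/
lemma lMirror_path {k : ℕ} {p : Fin (k + 3) → V} :
    LMirror (pathEnds p) (p 0) (pathPt (k := k)) := by
  intro b ε
  cases b with
  | inl i =>
    show hullPair (pathEnds p) (keyWord i (cubeNot ε)) (p 0) =
      (hullPair (pathEnds p) (keyWord i ε) (p 0)).swap
    rw [keyWord_cubeNot, hullPair_blue]
  | inr u =>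
    show hullPair (pathEnds p) (sentWord (cubeNot ε)) (p 0) =
      (hullPair (pathEnds p) (sentWord ε) (p 0)).swap
    rw [sentWord_cubeNot, hullPair_blue]

/-- The path cover with the marks renamed to those of a first path. -/
lemma cubeCover_path' {k : ℕ} {p : Fin (k + 3) → V} (hp : Function.Injective p) {l h : V}
    (h0 : p 0 = l) (hl : p (Fin.last (k + 2)) = h) :
    CubeCover (pathEnds p) l h (pathPt (k := k)) := by
  subst h0 hl
  exact cubeCover_path hp

/-- The mirror property with the mark renamed. -/
lemma lMirror_path' {k : ℕ} {p : Fin (k + 3) → V} {l : V} (h0 : p 0 = l) :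
    LMirror (pathEnds p) l (pathPt (k := k)) := by
  subst h0
  exact lMirror_path

/-- **The cube cover of two internally disjoint paths** (every cycle through the marks). -/
theorem cubeCover_twoPaths {k₁ k₂ : ℕ} {p₁ : Fin (k₁ + 3) → V} {p₂ : Fin (k₂ + 3) → V}
    (hp₁ : Function.Injective p₁) (hp₂ : Function.Injective p₂) {V₁ V₂ : Set V}
    (hg : IsGluing2 (pathEnds p₁) (pathEnds p₂) (p₁ 0) (p₁ (Fin.last (k₁ + 2))) V₁ V₂)
    (h0 : p₂ 0 = p₁ 0) (hlast : p₂ (Fin.last (k₂ + 2)) = p₁ (Fin.last (k₁ + 2))) :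
    CubeCover (glue2 (pathEnds p₁) (pathEnds p₂)) (p₁ 0) (p₁ (Fin.last (k₁ + 2)))
      (prodPt (pathPt (k := k₁)) (pathPt (k := k₂))) :=
  cubeCover_glue2 hg (cubeCover_path hp₁) (cubeCover_path' hp₂ h0 hlast) lMirror_path
    (lMirror_path' h0)

/-- The product cover of two paths mirrors the pair of `l`. -/
lemma lMirror_twoPaths {k₁ k₂ : ℕ} {p₁ : Fin (k₁ + 3) → V} {p₂ : Fin (k₂ + 3) → V}
    (hp₁ : Function.Injective p₁) (hp₂ : Function.Injective p₂) {V₁ V₂ : Set V}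
    (hg : IsGluing2 (pathEnds p₁) (pathEnds p₂) (p₁ 0) (p₁ (Fin.last (k₁ + 2))) V₁ V₂)
    (h0 : p₂ 0 = p₁ 0) (hlast : p₂ (Fin.last (k₂ + 2)) = p₁ (Fin.last (k₁ + 2))) :
    LMirror (glue2 (pathEnds p₁) (pathEnds p₂)) (p₁ 0)
      (prodPt (pathPt (k := k₁)) (pathPt (k := k₂))) :=
  lMirror_prod hg (cubeCover_path hp₁) (cubeCover_path' hp₂ h0 hlast) lMirror_path
    (lMirror_path' h0)

/-- **The cube cover of a theta graph with three paths.** -/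
theorem cubeCover_theta3 {k₁ k₂ k₃ : ℕ} {p₁ : Fin (k₁ + 3) → V} {p₂ : Fin (k₂ + 3) → V}
    {p₃ : Fin (k₃ + 3) → V} (hp₁ : Function.Injective p₁) (hp₂ : Function.Injective p₂)
    (hp₃ : Function.Injective p₃) {V₂ V₃ V₁ V₂₃ : Set V}
    (hg₂₃ : IsGluing2 (pathEnds p₂) (pathEnds p₃) (p₁ 0) (p₁ (Fin.last (k₁ + 2))) V₂ V₃)
    (hg₁ : IsGluing2 (pathEnds p₁) (glue2 (pathEnds p₂) (pathEnds p₃)) (p₁ 0)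
      (p₁ (Fin.last (k₁ + 2))) V₁ V₂₃)
    (h0₂ : p₂ 0 = p₁ 0) (hl₂ : p₂ (Fin.last (k₂ + 2)) = p₁ (Fin.last (k₁ + 2)))
    (h0₃ : p₃ 0 = p₁ 0) (hl₃ : p₃ (Fin.last (k₃ + 2)) = p₁ (Fin.last (k₁ + 2))) :
    CubeCover (glue2 (pathEnds p₁) (glue2 (pathEnds p₂) (pathEnds p₃))) (p₁ 0)
      (p₁ (Fin.last (k₁ + 2)))
      (prodPt (pathPt (k := k₁)) (prodPt (pathPt (k := k₂)) (pathPt (k := k₃)))) := by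
  have hg₂₃' : IsGluing2 (pathEnds p₂) (pathEnds p₃) (p₂ 0) (p₂ (Fin.last (k₂ + 2))) V₂ V₃ := by
    rw [h0₂, hl₂]; exact hg₂₃
  have c23 := cubeCover_twoPaths hp₂ hp₃ hg₂₃' (h0₃.trans h0₂.symm) (hl₃.trans hl₂.symm)
  have m23 := lMirror_twoPaths hp₂ hp₃ hg₂₃' (h0₃.trans h0₂.symm) (hl₃.trans hl₂.symm)
  rw [h0₂, hl₂] at c23
  rw [h0₂] at m23
  exact cubeCover_glue2 hg₁ (cubeCover_path hp₁) c23 lMirror_path m23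

/-- (MM) on every cycle through the marks, from the cube cover. -/
theorem twoHullMaster_twoPaths_of_cover {k₁ k₂ : ℕ} {p₁ : Fin (k₁ + 3) → V}
    {p₂ : Fin (k₂ + 3) → V} (hp₁ : Function.Injective p₁) (hp₂ : Function.Injective p₂)
    {V₁ V₂ : Set V}
    (hg : IsGluing2 (pathEnds p₁) (pathEnds p₂) (p₁ 0) (p₁ (Fin.last (k₁ + 2))) V₁ V₂)
    (h0 : p₂ 0 = p₁ 0) (hlast : p₂ (Fin.last (k₂ + 2)) = p₁ (Fin.last (k₁ + 2))) :
    TwoHullMaster (glue2 (pathEnds p₁) (pathEnds p₂)) (p₁ 0) (p₁ (Fin.last (k₁ + 2))) := by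
  haveI : ∀ b : (Fin k₁ ⊕ Unit) × (Fin k₂ ⊕ Unit), Fintype (pathι b.1 ⊕ pathι b.2) :=
    fun b => @instFintypeSum _ _ (pathιFintype b.1) (pathιFintype b.2)
  exact twoHullMaster_of_cubeCover (cubeCover_twoPaths hp₁ hp₂ hg h0 hlast)

end Blocks

end Summit.Ventures.PercRepro2
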